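import Mathlib
import Summits.Ventures.PercRepro.TriangleCapBowtie
import Summits.Ventures.PercRepro.TriangleCapCherryDiamond
import Summits.Ventures.PercRepro.TriangleCapDiagonal

/-!
# PercRepro — the `(5, 6)` row of the `K₄⁻`-free cherry table is exactly `10` in the kernel (p3, gen 30)

The engine's census (INBOX 12184, DATA-INDEX 840) reads `10` at `(k, m) = (5, 6)`: the bowtie (two triangles on a
common vertex) attains it (TriangleCapBowtie: `cherries_bowtie = 10`, `k4mFree_bowtie`, `card_edges_bowtie = 6`), and
no `K₄⁻`-free graph on `5` vertices with `6` edges beats it.  This module is the upper bound, so the row is exact: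

* `deg_le_two_of_deg_eq_four` — if some vertex has degree `4` (it sees everything), every other vertex has degree
  `≤ 2` (`deg_add_deg_le_succ_of_adj`: `d(v) + d(w) ≤ k + 1 = 6` on an edge of a `K₄⁻`-free graph);
* `cherries_le_ten_of_deg_eq_four` — then `cherries ≤ C(4, 2) + 4 · 1 = 10`;
* `one_le_deg_of_k4mFree` — no vertex is isolated: the other four would carry all `6` edges, i.e. `12 > 8` ordered
  adjacent pairs on a `4`-set;
* `cherries_le_ten_of_deg_le_three` — if every degree is `≤ 3` (hence in `{1, 2, 3}`), `2·C(d, 2) + 3 ≤ 3d`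
  termwise gives `2·cherries + 15 ≤ 3 · 12`, i.e. `cherries ≤ 10`;
* **`cherries_le_ten_of_k4mFree`** — every `K₄⁻`-free graph on `Fin 5` with `6` edges has `cherries ≤ 10`;
* **`five_six_exact`** — the `(5, 6)` row: the maximum is exactly `10`, attained by the bowtie.

Axioms: standard.
-/

namespace PercRepro

namespace TriangleCap

namespace C047

open Finset

/-- On `Fin 5` every degree is `≤ 4`. -/
theorem deg_le_four (D : SimpleGraph (Fin 5)) [DecidableRel D.Adj] (v : Fin 5) : deg D v ≤ 4 := by
  have hsub : univ.filter (fun w => D.Adj v w) ⊆ univ.erase v := by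
    intro w hw
    rw [mem_filter] at hw
    rw [mem_erase]
    exact ⟨(D.ne_of_adj hw.2).symm, mem_univ _⟩
  have h := card_le_card hsub
  rw [card_erase_of_mem (mem_univ v), card_univ, Fintype.card_fin] at h
  exact h

/-- A vertex of degree `4` on `Fin 5` is adjacent to every other vertex. -/
theorem adj_of_deg_eq_four (D : SimpleGraph (Fin 5)) [DecidableRel D.Adj] {v : Fin 5} (hv : deg D v = 4)
    {w : Fin 5} (hw : w ≠ v) : D.Adj v w := by
  have hsub : univ.filter (fun x => D.Adj v x) ⊆ univ.erase v := by
    intro x hx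
    rw [mem_filter] at hx
    rw [mem_erase]
    exact ⟨(D.ne_of_adj hx.2).symm, mem_univ _⟩
  have hcard : (univ.erase v).card ≤ (univ.filter (fun x => D.Adj v x)).card := by
    rw [card_erase_of_mem (mem_univ v), card_univ, Fintype.card_fin]
    unfold deg at hv
    omega
  have heq := eq_of_subset_of_card_le hsub hcard
  have hmem : w ∈ univ.erase v := mem_erase.mpr ⟨hw, mem_univ _⟩
  rw [← heq, mem_filter] at hmem
  exact hmem.2

/-- In a `K₄⁻`-free graph on `Fin 5` with a vertex of degree `4`, every other vertex has degree `≤ 2`. -/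
theorem deg_le_two_of_deg_eq_four (D : SimpleGraph (Fin 5)) [DecidableRel D.Adj] (hK : K4mFree D)
    {v : Fin 5} (hv : deg D v = 4) {w : Fin 5} (hw : w ≠ v) : deg D w ≤ 2 := by
  have h := deg_add_deg_le_succ_of_adj D hK (adj_of_deg_eq_four D hv hw)
  rw [Fintype.card_fin] at h
  omega

/-- **The degree-`4` case:** `cherries ≤ C(4, 2) + 4 = 10`. -/
theorem cherries_le_ten_of_deg_eq_four (D : SimpleGraph (Fin 5)) [DecidableRel D.Adj] (hK : K4mFree D)
    {v : Fin 5} (hv : deg D v = 4) : cherries D ≤ 10 := by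
  unfold cherries
  rw [← add_sum_erase univ _ (mem_univ v), hv]
  have hrest : ∑ x ∈ univ.erase v, (deg D x).choose 2 ≤ ∑ _x ∈ univ.erase v, 1 :=
    sum_le_sum (fun x hx =>
      choose_two_le_one_of_le_two _ (deg_le_two_of_deg_eq_four D hK hv (mem_erase.mp hx).1))
  rw [sum_const, smul_eq_mul, mul_one, card_erase_of_mem (mem_univ v), card_univ, Fintype.card_fin] at hrest
  have h6 : Nat.choose 4 2 = 6 := by decide
  omega

/-- The ordered adjacent pairs are the pairs inside `univ.erase u` together with those touching `u`. -/
theorem card_adjPairsAll_le_adjPairs_erase {V : Type*} [Fintype V] [DecidableEq V] (D : SimpleGraph V)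
    [DecidableRel D.Adj] (u : V) :
    (adjPairsAll D).card ≤ adjPairs D (univ.erase u) + deg D u + deg D u := by
  have hsub : adjPairsAll D ⊆ ((univ.erase u ×ˢ univ.erase u).filter (fun p => D.Adj p.1 p.2) ∪
      (adjPairsAll D).filter (fun p => p.1 = u)) ∪ (adjPairsAll D).filter (fun p => p.2 = u) := by
    intro p hp
    rw [mem_union, mem_union, mem_filter, mem_filter, mem_filter, mem_product, mem_erase, mem_erase]
    by_cases h1 : p.1 = u
    · exact Or.inl (Or.inr ⟨hp, h1⟩)
    · by_cases h2 : p.2 = u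
      · exact Or.inr ⟨hp, h2⟩
      · exact Or.inl (Or.inl ⟨⟨⟨h1, mem_univ _⟩, ⟨h2, mem_univ _⟩⟩, (mem_filter.mp hp).2⟩)
  calc (adjPairsAll D).card
      ≤ (((univ.erase u ×ˢ univ.erase u).filter (fun p => D.Adj p.1 p.2) ∪
          (adjPairsAll D).filter (fun p => p.1 = u)) ∪ (adjPairsAll D).filter (fun p => p.2 = u)).card :=
        card_le_card hsub
    _ ≤ ((univ.erase u ×ˢ univ.erase u).filter (fun p => D.Adj p.1 p.2) ∪
          (adjPairsAll D).filter (fun p => p.1 = u)).card + ((adjPairsAll D).filter (fun p => p.2 = u)).card :=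
        card_union_le _ _
    _ ≤ ((univ.erase u ×ˢ univ.erase u).filter (fun p => D.Adj p.1 p.2)).card +
          ((adjPairsAll D).filter (fun p => p.1 = u)).card + ((adjPairsAll D).filter (fun p => p.2 = u)).card := by
        gcongr
        exact card_union_le _ _
    _ = adjPairs D (univ.erase u) + deg D u + deg D u := by
        rw [card_filter_fst_eq, card_filter_snd_eq]
        rfl

/-- **No isolated vertex:** in a `K₄⁻`-free graph on `Fin 5` with `6` edges every degree is `≥ 1` (an isolated
vertex leaves all `12` ordered adjacent pairs on the other four vertices). -/
theorem one_le_deg_of_k4mFree (D : SimpleGraph (Fin 5)) [DecidableRel D.Adj] (hK : K4mFree D)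
    (hm : D.edgeFinset.card = 6) (u : Fin 5) : 1 ≤ deg D u := by
  by_contra h0
  have hu : deg D u = 0 := by omega
  have h := card_adjPairsAll_le_adjPairs_erase D u
  rw [card_adjPairsAll, hm, hu] at h
  have h4 : adjPairs D (univ.erase u) ≤ 8 :=
    hK _ (by rw [card_erase_of_mem (mem_univ u), card_univ, Fintype.card_fin])
  omega

/-- `2·C(d, 2) + 3 ≤ 3d` for `1 ≤ d ≤ 3`. -/
theorem two_mul_choose_two_add_three_le (d : ℕ) (h1 : 1 ≤ d) (h3 : d ≤ 3) :
    2 * d.choose 2 + 3 ≤ 3 * d := by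
  interval_cases d <;> decide

/-- **The maximum-degree-`≤ 3` case:** with every degree in `{1, 2, 3}`, `2·cherries + 15 ≤ 3 · 12`. -/
theorem cherries_le_ten_of_deg_le_three (D : SimpleGraph (Fin 5)) [DecidableRel D.Adj] (hK : K4mFree D)
    (hm : D.edgeFinset.card = 6) (h3 : ∀ v, deg D v ≤ 3) : cherries D ≤ 10 := by
  have hsum : ∑ v, (2 * (deg D v).choose 2 + 3) ≤ ∑ v, 3 * deg D v :=
    sum_le_sum (fun v _ => two_mul_choose_two_add_three_le _ (one_le_deg_of_k4mFree D hK hm v) (h3 v))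
  rw [sum_add_distrib, ← mul_sum, ← mul_sum, sum_const, smul_eq_mul, card_univ, Fintype.card_fin,
    sum_deg_eq, hm] at hsum
  unfold cherries
  omega

/-- **THE `(5, 6)` UPPER BOUND:** every `K₄⁻`-free graph on `Fin 5` with `6` edges has `Σ_v C(d(v), 2) ≤ 10`. -/
theorem cherries_le_ten_of_k4mFree (D : SimpleGraph (Fin 5)) [DecidableRel D.Adj] (hK : K4mFree D)
    (hm : D.edgeFinset.card = 6) : cherries D ≤ 10 := by
  by_cases h4 : ∃ v, deg D v = 4
  · obtain ⟨v, hv⟩ := h4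
    exact cherries_le_ten_of_deg_eq_four D hK hv
  · push Not at h4
    refine cherries_le_ten_of_deg_le_three D hK hm (fun v => ?_)
    have := deg_le_four D v
    have := h4 v
    omega

/-- **THE `(5, 6)` ROW IS EXACT:** the `K₄⁻`-free cherry maximum on `5` vertices with `6` edges is `10`, attained
by the bowtie. -/
theorem five_six_exact :
    (∀ (D : SimpleGraph (Fin 5)) [DecidableRel D.Adj], K4mFree D → D.edgeFinset.card = 6 → cherries D ≤ 10) ∧
      ∃ (D : SimpleGraph (Fin 5)) (_ : DecidableRel D.Adj),
        K4mFree D ∧ D.edgeFinset.card = 6 ∧ cherries D = 10 :=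
  ⟨fun D _ hK hm => cherries_le_ten_of_k4mFree D hK hm,
    ⟨bowtie, inferInstance, k4mFree_bowtie, card_edges_bowtie, cherries_bowtie⟩⟩

end C047

end TriangleCap

end PercRepro
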